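import Summits.Ventures.HodgeRepro.Night1AndreOrbits
import Summits.Ventures.HodgeRepro.Night1ProductLineReduce

/-!
# Lemma R's pull-back half on the kernel: the `σ`-line of `W_F(B)` is the `lineSet σ`-component of the
pull-back `m^* e_{U_σ}` of the reduced Hodge class of `B_red` along the sum map `B → B_red`

Blind re-derivation cell `pub-hodge-repro`, seat `night-1` (gen 6).  Imports night-1's `Night1AndreOrbits`
(the dual functionals `setDual` of coordinate wedges) and `Night1ProductLineReduce` (p377594: the twist map
`twistMap cls tw : ι × G → J × G`, `(i, x) ↦ (cls i, x (tw i)⁻¹)`, injective on every `σ`-line for injective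
`(cls, tw)`, carrying the `σ`-line set onto typer's reduced set `U_σ = reducedSet cls tw σ`; the reduced-side
enumeration `reducedEnum cls tw e σ = twistMap cls tw ∘ lineEnum e σ`).  Namespace `HodgeRepro.RouteC`.

ROUTE.md §1 row S3ᴿ (Lemma R, the lead's converse of S3 — UNPRINTED, routine) reads: «`W_F(B)` lies in the
`ℚ`-span of the pull-backs, along algebraic morphisms `B → B_red := ∏_j A_j`, of the codimension-`p` Hodge
classes of `B_red` — these being the Pohlmann lines of the `2p`-sets `{(j(i), s·g_i⁻¹)}`.  Proof: over `ℂ`,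
`W_F(B) = ⊕_s ⊗_i ℓ^{(i)}_s` …; distinct characters within a class make `⊗` a component of `m^*(∧)` for the
sum map `m`; … Artin independence of the characters … isolates each eigen-component of a `ℚ`-rational
pull-back»; its status line: «combinatorial core CHECKED (typer's `FaceReduce`); the geometric half (sum map,
Artin, pull-back) is paper-level».  This file puts the LINEAR ALGEBRA of that half on the kernel:

* `pullLin θ` — the pull-back along a map of finite sets on coordinate functions, `e_z ↦ Σ_{θ y = z} e_y`
  (`LinearMap.funLeft`): `m^*` on `H¹` in eigen-coordinates, for `θ = twistMap cls tw` (the sum map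
  `∏_{i ∈ class j} A_{Φ j · tw i} → A_{Φ j}` pulls the `x`-eigenline of `A_{Φ j}` back to the `x·tw i`-eigenlines
  of the factors of its class — `pullLin_coordVecOn`);
* **`map_pullLin_coordWedgeOn`** — the pull-back of a coordinate wedge is the sum of the coordinate wedges of
  ALL its lifts (`MultilinearMap.map_sum_finset`);
* **`setDual_map_pullLin_coordWedgeOn`** — for `s` injective and `θ` injective on `range s`, the wedge `e_s`
  has coefficient exactly `1` in the pull-back of `e_{θ ∘ s}` (the pairing matrix is the identity);
* `wedgeComponent s` — the projection `ω ↦ ⟨e^*_s, ω⟩ e_s` onto the `e_s`-component (the eigen-component for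
  the torus `(ℂ^×)^{ι × G}` = `(F^ι ⊗ ℂ)^×`, whose weight vectors are the coordinate wedges — `map_torusOn_coordWedgeOn`);
* **`wedgeComponent_lineEnum_map_pullLin_reducedWedge`** — LEMMA R's SENTENCE: for injective `(cls, tw)` the
  `σ`-line `weilWedgeProd e σ` of `W_F(B)` IS the `lineSet σ`-component of `m^* e_{U_σ}`, the pull-back of
  the reduced Pohlmann wedge of `B_red` (`setDual_lineEnum_map_pullLin_reducedWedge`: coefficient `1`);
  hence **`weilSpaceProd_le_iSup_range_wedgeComponent_pullLin`**: `W_F(B) ⊗ ℂ` lies in the sum of the images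
  of the component projections applied to the pull-backs of the Hodge classes of `B_red`.

What stays paper-level (ROUTE.md S3ᴿ, NIGHT1.md §12): that the sum map is an algebraic morphism and `m^*`
its pull-back; that the eigen-component projections are `ℚ`-polynomials in the correspondences `a^*`,
`a ∈ (F^ι)^×` (Artin independence; typer-2's `Isotypic.lean` has the projector-as-polynomial lemma), so that
HC in codimension `p` for `B_red` makes the `σ`-lines, hence `W_F(B)`, algebraic.  Nothing geometric is built;
every statement is about coordinate wedges on finite `G`-sets.  Nothing here says anything about the status
of the Hodge conjecture for CM abelian varieties, which is NOT proved.
-/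

set_option autoImplicit false

open Finset Module
open scoped Pointwise

namespace HodgeRepro.RouteC

open CMHodgeOn

/-! ### The pull-back along a map of finite sets and its action on coordinate wedges -/

section Pull

variable {Y Z : Type*} [Fintype Y] [DecidableEq Y] [DecidableEq Z]

/-- The pull-back along `θ : Y → Z` on coordinate functions (precomposition, `LinearMap.funLeft`):
`e_z ↦ Σ_{θ y = z} e_y` — `m^*` on `H¹` in eigen-coordinates for a morphism `m` whose induced map of
embeddings is `θ`. -/
def pullLin (θ : Y → Z) : (Z → ℂ) →ₗ[ℂ] (Y → ℂ) := LinearMap.funLeft ℂ ℂ θ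

omit [Fintype Y] [DecidableEq Y] [DecidableEq Z] in
/-- The pull-back, pointwise. -/
@[simp] theorem pullLin_apply (θ : Y → Z) (w : Z → ℂ) (y : Y) : pullLin θ w y = w (θ y) := rfl

/-- The pull-back of the coordinate vector `e_z` is the sum of the coordinate vectors of its lifts. -/
theorem pullLin_coordVecOn (θ : Y → Z) (z : Z) :
    pullLin θ (coordVecOn z) = ∑ y ∈ univ.filter fun y => θ y = z, coordVecOn y := by
  funext y'
  simp only [pullLin_apply, coordVecOn_apply, Finset.sum_apply, Finset.sum_ite_eq, mem_filter, mem_univ,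
    true_and]

/-- **The pull-back of a coordinate wedge is the sum of the coordinate wedges of all its lifts**: for
`u : Fin n → Z`, `⋀^n (pullLin θ) e_u = Σ_ℓ e_ℓ` over the `ℓ : Fin n → Y` with `θ ∘ ℓ = u`. -/
theorem map_pullLin_coordWedgeOn (θ : Y → Z) {n : ℕ} (u : Fin n → Z) :
    exteriorPower.map n (pullLin θ) (coordWedgeOn n u) =
      ∑ ℓ ∈ Fintype.piFinset fun j => univ.filter fun y => θ y = u j, coordWedgeOn n ℓ := by
  unfold coordWedgeOn
  rw [exteriorPower.map_apply_ιMulti]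
  have h : (pullLin θ ∘ fun j => coordVecOn (u j)) =
      fun j => ∑ y ∈ univ.filter fun y => θ y = u j, coordVecOn y := by
    funext j
    exact pullLin_coordVecOn θ (u j)
  rw [h]
  exact MultilinearMap.map_sum_finset (exteriorPower.ιMulti ℂ n).toMultilinearMap
    (fun j (y : Y) => coordVecOn y) (fun j => univ.filter fun y => θ y = u j)

omit [Fintype Y] [DecidableEq Y] in
/-- **The coefficient of a lift**: for `s` injective and `θ` injective on `range s`, the dual functional of
`e_s` takes the value `1` on the pull-back of `e_{θ ∘ s}` — the pairing matrix
`(e^*_{s b} (pullLin θ e_{θ (s a)}))_{a b} = (θ (s b) = θ (s a))_{a b}` is the identity. -/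
theorem setDual_map_pullLin_coordWedgeOn {θ : Y → Z} {n : ℕ} {s : Fin n → Y}
    (hs : Function.Injective s) (hθ : Set.InjOn θ (Set.range s)) :
    setDual s (exteriorPower.map n (pullLin θ) (coordWedgeOn n (θ ∘ s))) = 1 := by
  unfold setDual coordWedgeOn
  rw [exteriorPower.map_apply_ιMulti, exteriorPower.pairingDual_ιMulti_ιMulti]
  have h : (Matrix.of fun a b : Fin n =>
      (LinearMap.proj (s b) : (Y → ℂ) →ₗ[ℂ] ℂ) ((pullLin θ ∘ fun j => coordVecOn ((θ ∘ s) j)) a)) =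
      (1 : Matrix (Fin n) (Fin n) ℂ) := by
    ext a b
    rw [Matrix.of_apply, LinearMap.proj_apply, Function.comp_apply, pullLin_apply, Function.comp_apply,
      coordVecOn_apply, Matrix.one_apply]
    by_cases hab : a = b
    · subst hab
      simp
    · rw [if_neg, if_neg hab]
      intro hEq
      exact hab (hs (hθ ⟨b, rfl⟩ ⟨a, rfl⟩ hEq)).symm
  rw [h, Matrix.det_one]

end Pull

/-! ### The component projections and the torus whose weight vectors are the coordinate wedges -/

section Component

variable {Y : Type*} [DecidableEq Y]

/-- The projection onto the `e_s`-component: `ω ↦ ⟨e^*_s, ω⟩ • e_s`. -/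
noncomputable def wedgeComponent {n : ℕ} (s : Fin n → Y) :
    ⋀[ℂ]^n (Y → ℂ) →ₗ[ℂ] ⋀[ℂ]^n (Y → ℂ) :=
  (setDual s).smulRight (coordWedgeOn n s)

/-- The component projection, applied. -/
theorem wedgeComponent_apply {n : ℕ} (s : Fin n → Y) (ω : ⋀[ℂ]^n (Y → ℂ)) :
    wedgeComponent s ω = setDual s ω • coordWedgeOn n s :=
  LinearMap.smulRight_apply _ _ _

/-- The component projection fixes `e_s` (`s` injective). -/
theorem wedgeComponent_coordWedgeOn_self {n : ℕ} {s : Fin n → Y} (hs : Function.Injective s) :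
    wedgeComponent s (coordWedgeOn n s) = coordWedgeOn n s := by
  rw [wedgeComponent_apply, setDual_coordWedgeOn_self hs, one_smul]

/-- The component projection kills the wedges of the other sets. -/
theorem wedgeComponent_coordWedgeOn_of_image_ne {n : ℕ} {s s' : Fin n → Y} (hs : Function.Injective s)
    (hs' : Function.Injective s') (h : univ.image s ≠ univ.image s') :
    wedgeComponent s (coordWedgeOn n s') = 0 := by
  rw [wedgeComponent_apply, setDual_coordWedgeOn_of_image_ne hs hs' h, zero_smul]

/-- The diagonal torus `(ℂ^×)^Y = (F^ι ⊗ ℂ)^×` acting on `ℂ^Y`: `t` multiplies the `y`-coordinate by `t y`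
(typer-2's `cocharOn Φ λ` is the element `t = λ` on `Φ`, `1` off `Φ`). -/
def torusOn (t : Y → ℂ) : (Y → ℂ) →ₗ[ℂ] (Y → ℂ) where
  toFun v := fun y => t y * v y
  map_add' v w := by
    funext y
    simp only [Pi.add_apply, mul_add]
  map_smul' r v := by
    funext y
    simp only [Pi.smul_apply, smul_eq_mul, RingHom.id_apply]
    ring

/-- The torus acts on `e_y` by the scalar `t y`. -/
theorem torusOn_coordVecOn (t : Y → ℂ) (y : Y) : torusOn t (coordVecOn y) = t y • coordVecOn y := by
  funext y'
  simp only [torusOn, LinearMap.coe_mk, AddHom.coe_mk, coordVecOn_apply, Pi.smul_apply, smul_eq_mul]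
  by_cases h : y' = y
  · subst h
    simp
  · simp [h]

/-- **The coordinate wedges are the weight vectors of the torus**: `⋀^n (torusOn t) e_s = (∏_j t (s j)) • e_s`
— distinct sets, distinct characters `t ↦ ∏_{y ∈ S} t y` (the model-side «Artin independence of the
characters» of ROUTE.md S3ᴿ). -/
theorem map_torusOn_coordWedgeOn (t : Y → ℂ) {n : ℕ} (s : Fin n → Y) :
    exteriorPower.map n (torusOn t) (coordWedgeOn n s) = (∏ j, t (s j)) • coordWedgeOn n s := by
  unfold coordWedgeOn
  rw [exteriorPower.map_apply_ιMulti]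
  have h : (torusOn t ∘ fun j => coordVecOn (s j)) = fun j => t (s j) • coordVecOn (s j) := by
    funext j
    exact torusOn_coordVecOn t (s j)
  rw [h]
  exact AlternatingMap.map_smul_univ (exteriorPower.ιMulti ℂ n) (fun j => t (s j))
    (fun j => coordVecOn (s j))

end Component

/-! ### Lemma R's sentence: the `σ`-line is the `lineSet σ`-component of the pull-back of `e_{U_σ}` -/

section LemmaR

variable {G : Type*} [Group G] [DecidableEq G] [Fintype G] {ι J : Type*} [Fintype ι] [DecidableEq ι]
  [DecidableEq J]

omit [Fintype G] in
/-- **Coefficient `1`**: for injective `(cls, tw)`, the `σ`-line `e_{lineSet σ}` of `B = ∏_i A_{Φ (cls i) · tw i}`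
has coefficient `1` in the pull-back along the twist map of the reduced wedge `e_{U_σ}` of `B_red`. -/
theorem setDual_lineEnum_map_pullLin_reducedWedge {cls : ι → J} {tw : ι → G}
    (hinj : Function.Injective fun i => (cls i, tw i)) {k : ℕ} (e : Fin (2 * k) ≃ ι) (σ : G) :
    setDual (lineEnum e σ) (exteriorPower.map (2 * k) (pullLin (twistMap cls tw))
      (coordWedgeOn (2 * k) (reducedEnum cls tw e σ))) = 1 := by
  rw [reducedEnum_eq_twistMap_comp_lineEnum]
  refine setDual_map_pullLin_coordWedgeOn (lineEnum_injective e σ) ?_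
  have h := injOn_twistMap_lineSet hinj (ι := ι) σ
  rw [← image_lineEnum e σ, Finset.coe_image] at h
  exact h.mono (by rw [Finset.coe_univ, Set.image_univ])

omit [Fintype G] in
/-- **LEMMA R's SENTENCE ON THE KERNEL** (ROUTE.md S3ᴿ: «distinct characters within a class make `⊗` a
component of `m^*(∧)` for the sum map `m`»): for injective `(cls, tw)`, the `σ`-line `weilWedgeProd e σ` of
`W_F(B)` is the `lineSet σ`-component of the pull-back `m^* e_{U_σ}` of the reduced Pohlmann wedge of
`B_red = ∏_j A_{Φ j}` along the sum map. -/
theorem wedgeComponent_lineEnum_map_pullLin_reducedWedge {cls : ι → J} {tw : ι → G}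
    (hinj : Function.Injective fun i => (cls i, tw i)) {k : ℕ} (e : Fin (2 * k) ≃ ι) (σ : G) :
    wedgeComponent (lineEnum e σ) (exteriorPower.map (2 * k) (pullLin (twistMap cls tw))
      (coordWedgeOn (2 * k) (reducedEnum cls tw e σ))) = weilWedgeProd e σ := by
  rw [wedgeComponent_apply, setDual_lineEnum_map_pullLin_reducedWedge hinj e σ, one_smul]
  rfl

omit [Fintype G] in
/-- **`W_F(B) ⊗ ℂ` lies in the sum of the images of the component projections applied to the pull-backs**
of the classes of `B_red` — the shape in which Lemma R hands `W_F(B)` to «HC in codimension `p` for `B_red`». -/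
theorem weilSpaceProd_le_iSup_range_wedgeComponent_pullLin {cls : ι → J} {tw : ι → G}
    (hinj : Function.Injective fun i => (cls i, tw i)) {k : ℕ} (e : Fin (2 * k) ≃ ι) :
    weilSpaceProd G k e ≤ ⨆ σ : G, LinearMap.range
      (wedgeComponent (lineEnum e σ) ∘ₗ exteriorPower.map (2 * k) (pullLin (twistMap cls tw))) := by
  rw [weilSpaceProd, Submodule.span_le]
  rintro _ ⟨σ, rfl⟩
  refine Submodule.mem_iSup_of_mem σ ⟨coordWedgeOn (2 * k) (reducedEnum cls tw e σ), ?_⟩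
  rw [LinearMap.comp_apply]
  exact wedgeComponent_lineEnum_map_pullLin_reducedWedge hinj e σ

/-- **LEMMA R ON THE KERNEL (existence form)**: for a `SumP k` corner family `corner Φ cls tw` with injective
`(cls, tw)`, every `σ`-line of `W_F(B)` is the `lineSet σ`-component of the pull-back `m^* ω` of a HODGE CLASS
`ω` of `B_red` (a joint `(k, k)`-class of the conjugate cocharacters of the product type, typer-2's
dictionary; `ω = e_{U_σ}`, `Night1ReducedLevelK.reducedWedge_mem_jointEigenspaceOn`). -/
theorem exists_mem_jointEigenspaceOn_wedgeComponent_map_pullLin_eq [Fintype J] {c : G}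
    (hc : IsComplexConj c) {Φ : J → Finset G} (hΦ : ∀ j, IsCMType c (Φ j)) {cls : ι → J} {tw : ι → G}
    (hinj : Function.Injective fun i => (cls i, tw i)) {k : ℕ} (hsum : SumP k (corner Φ cls tw))
    (e : Fin (2 * k) ≃ ι) (σ : G) :
    ∃ ω ∈ jointEigenspaceOn (fun g : G => prodTypeSet fun j => g • Φ j) (2 * k) k,
      wedgeComponent (lineEnum e σ) (exteriorPower.map (2 * k) (pullLin (twistMap cls tw)) ω) =
        weilWedgeProd e σ :=
  ⟨coordWedgeOn (2 * k) (reducedEnum cls tw e σ), reducedWedge_mem_jointEigenspaceOn hc hΦ hinj hsum e σ,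
    wedgeComponent_lineEnum_map_pullLin_reducedWedge hinj e σ⟩

end LemmaR

end HodgeRepro.RouteC
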